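import Literature.NumberTheory.EllipticCurves.KummerSelmerStructure
import Literature.NumberTheory.EllipticCurves.QuadraticTwist
import HarnessLib

/-!
# Mazur–Rubin 2010, *Ranks of twists of elliptic curves and Hilbert's tenth problem*,
# Theorem 2.7 (Kramer's congruence) with Definition 2.6 / Lemma 2.9: the PARITY of `d₂(E^F/K) − d₂(E/K)`
# is the number of places where the two local Kummer conditions differ, counted with dimension — AS PRINTED,
# every number field `K`, `p = 2`

HONEST FRAMING (cell `bsd-f1-sign2`, width seat `bsd-line-gk2-p5` g9, route `GenusKolyvaginAtTwo`, crux
stmt-BirchSwinnertonDyer-22136): a PUBLISHED theorem vendored as a named `Prop` (nothing asserted, nothing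
discharged; D-0014), every printed hypothesis a binder, with locators into the held text. It is the PARITY input
that the printed UP direction of Mazur–Rubin's Cor. 3.4 (i) («`Sel₂(E)` strict at the twisting prime ⟹ `d₂` goes up
by one») uses beyond Poitou–Tate duality — Prop. 3.3's clause `d ≡ dim(⊕ H¹_f/V_T) (mod 2)` is derived from it
[p0010 L35: "so `d₂(E^F/K) ≡ d₂(E/K) + t (mod 2)` by Kramer's congruence (Theorem 2.7)"]. The tree already holds the
LINEAR-ALGEBRA form of this parity for abstract quadratic Selmer structures (Klagsbrun–Mazur–Rubin 2013 Thm. 3.9,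
`QuadraticSelmerStructure.finrank_selmerGroup_sub_modEq`, proved) but not its arithmetic instantiation (the
Poonen–Rains quadratic forms on `H¹(K_v, E[2])`); this file records the arithmetic statement itself, as printed by
Mazur–Rubin after Kramer, in the currency of the tree's Kummer Selmer structures (`WeierstrassCurve.kummerSelmerStructure`,
`KummerSelmerStructure.lean`) in which the cell's transfer theorems are written (X11b `CongruentTransfer`, transported
structure `𝓐 = φ_* 𝓚_{E^F}`). It closes nothing by itself.

Source. B. Mazur, K. Rubin, *Ranks of twists of elliptic curves and Hilbert's tenth problem*, Invent. Math. 181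
(2010), 541–575 [MazurRubin2010]. Text read: the held DASH author manuscript
`paper:anon2010-ranks-twists-elliptic-curves-hilberts-tenth-problem` (27 pp.; locators `pNNNN.txt:Lk`, journal
numbering), cross-checked against arXiv:0904.3709 (`paper:arxiv-0904.3709`, TeX counter: Def 20 / Thm 21 / Rem 22 /
Lemma 23). The theorem is Kramer's: K. Kramer, *Arithmetic of elliptic curves upon quadratic extension*, Trans.
AMS 264 (1981) 121–135 [Kramer1981] (held, `paper:doi-10-1090-s0002-9947-1981-0597871-8`), Thm. 1 (p. 130) with Thm. 2
(p. 132) and Prop. 7 / eq. (11) (pp. 130, 132), over an arbitrary number field and at `p = 2`.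

## The printed statements (verbatim)

* §2 standing (p0006 L27; p0007 L52–L54): "Fix for this section a number field `K`. … Fix for the rest of this
  section an elliptic curve `E/K` and a quadratic extension `F/K`. Recall that `E^F` is the twist of `E` by `F/K`."
  Def. 2.3 (p0007 L5–L22): "`0 → Sel₂(E/K) → H¹(K, E[2]) → ⊕_v H¹(K_v, E[2])/H¹_f(K_v, E[2])` … `d₂(E/K) := dim_{𝔽₂} Sel₂(E/K)`."
* **Remark 2.4** (p0007 L23–L28): "If `E` is an elliptic curve over `K` and `E^F` is a quadratic twist, then there
  is a natural identification of Galois modules `E[2] = E^F[2]`. This allows us to view `Sel₂(E/K), Sel₂(E^F/K) ⊂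
  H¹(K, E[2])`, defined by different sets of local conditions."
* **Definition 2.6** (p0007 L55–L58): "If `v` is a place of `K`, let `E_N(K_v) ⊂ E(K_v)` denote the image of the
  norm map `E(F_w) → E(K_v)` for any choice of `w` above `v` (this is independent of the choice of `w`), and define
  `δ_v(E, F/K) := dim_{𝔽₂}(E(K_v)/E_N(K_v))`."
* **Theorem 2.7 (Kramer)** (p0007 L59–L66): "We have `d₂(E^F/K) ≡ d₂(E/K) + Σ_v δ_v(E, F/K) (mod 2)`." Proof
  (p0008 L1–L14): "This is a consequence of [Kr, Theorem 1]. Combining Theorems 1 and 2 of [Kr] shows that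
  `rank(E(F)) + dim_{𝔽₂}(Ш(E/F)[2]) ≡ Σ_v δ_v(E, F/K) (mod 2)`. By (1), the left-hand side of this congruence is
  `d₂(E/F) − dim_{𝔽₂}(E(F)[2])`, and by Lemma 2.5 this is congruent to `d₂(E/K) + d₂(E^F/K)`." Remark 2.8 (p0008
  L16–L20): "A key step in Kramer's proof is the following remarkable construction. There are alternating Cassels
  pairings `h_E` on `Sel₂(E/K)` and `h_{E^F}` on `Sel₂(E^F/K)`. Their sum is a new alternating pairing on
  `Sel₂(E/K) ∩ Sel₂(E^F/K)`, and Kramer shows [Kr, Theorem 2] that the kernel of `h_E + h_{E^F}` is `N_{F/K} Sel₂(E/F)`."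
* **Lemma 2.9** (p0008 L21–L24): "Under the identification `H¹_f(K_v, E[2]) = E(K_v)/2E(K_v)`, we have
  `H¹_f(K_v, E[2]) ∩ H¹_f(K_v, E^F[2]) = E_N(K_v)/2E(K_v)`. Proof. This is [Kr, Proposition 7] or [MR2, Proposition
  5.2] (the proof given in [MR2] works even if `p = 2`, and even if `v | ∞`)."
  (Kramer 1981 p. 132: "We continue to identify the Galois-isomorphic modules `E₂` and `E₂^{(d)}`. … PROPOSITION 7.
  Locally, `i_v⁻¹(S'_v) = S_v · S_v^{(d)}` and `N_v S'_v = S_v ∩ S_v^{(d)}` all viewed as subgroups of `H¹(F_v, E₂)`";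
  eq. (11) p. 130: "`i_v = dim E(F_v)/N{E(K_w)} = dim S_v/N_v S'_v`".)

## Transcription (tree dictionary), every number field `K`, `p = 2`

* `E/K` = a Weierstrass model `W : WeierstrassCurve K` with `[W.IsElliptic]`; `F = K(√d)` quadratic = `d : K` with
  `∀ x, x² ≠ d`; the twist `E^F` = any model `W'` with `C • W' = W.quadraticTwist d` (idiom of `QuadraticTwist.lean`
  and of `cor34ii_rat` in this story; `W.quadraticTwist d : y² = x³ + d(b₂/4)x² + d²(b₄/2)x + d³(b₆/4)` is `K(√d)`-isomorphic
  to `W`, i.e. it IS the twist of `E` by `F/K`).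
* `Sel₂(E/K)` = `W.selmerGroup 2 ⊆ H¹(K, E[2])` (= the Selmer group of the Kummer Selmer structure,
  `selmerGroup_eq_selmerGroup_kummerSelmerStructure`); `2^{d₂(E/K)} = Nat.card (W.selmerGroup 2)`.
* `H¹_f(K_v, E[2])` (at EVERY place `v`, finite or infinite) = the local condition `W.kummerSelmerStructure 2 v` of
  `KummerSelmerStructure.lean` (the kernel of `H¹(K_v, E[2]) → H¹(K_v, E)`, = the image of `E(K_v)/2E(K_v)` by
  `mem_kummerLocalConditionAt_iff_exists_eq_localKummerClass`).
* "the natural identification `E^F[2] = E[2]`" (Remark 2.4; Kramer §5) = a continuous `Γ_K`-intertwining map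
  `φ : W'[2](K̄) → W[2](K̄)` (`(W'.torsionGaloisModule 2).toContRepresentation →ⁱL (W.torsionGaloisModule 2).toContRepresentation`,
  the X11b / gk2 currency) which is injective and is the ONLY injective intertwining map (binder `huniq`: every
  injective intertwining `φ'` agrees with `φ` pointwise). Under `huniq` the arbitrary `φ` coincides with the printed
  identification (which is one such map), so nothing stronger than print is stated; `huniq` holds whenever
  `Aut_{Γ_K}(E[2]) = 1`, e.g. for `ρ̄_{E,2}` onto (gk2 `intertwining_apply_eq_of_hasSurjectiveModNGaloisRep_two`).
  `H¹_f(K_v, E^F[2]) ⊂ H¹(K_v, E[2])` = the transported condition `𝓐 v = (W'.kummerSelmerStructure 2 v).map H¹(φ_v)`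
  (binder `h𝓐`, verbatim as in X11b `CongruentTransfer`).
* `δ_v(E, F/K)` is read through Lemma 2.9: `2^{δ_v} = [H¹_f(K_v,E[2]) : H¹_f(K_v,E[2]) ∩ H¹_f(K_v,E^F[2])]`
  `= (𝓐 v).relIndex (W.kummerSelmerStructure 2 v)` (Mathlib's `AddSubgroup.relIndex H K = [K : H ⊓ K]`).
* "`Σ_v δ_v`" (all places; finitely many non-zero terms) = `Σ_{v ∈ S}` for ANY finite `S : Finset (Place K)` off
  which the two conditions agree (binder: `∀ v ∉ S, 𝓐 v = W.kummerSelmerStructure 2 v`; there `δ_v = 0`).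
* The congruence `d₂(E^F) ≡ d₂(E) + Σ δ_v (mod 2)` ⟺ `d₂(E^F) + d₂(E) + Σ_v δ_v` is even ⟺ (all three factors being
  powers of `2`) `#Sel₂(E^F) · #Sel₂(E) · ∏_{v∈S} 2^{δ_v}` is a perfect square — the form stated (`IsSquare`, as in
  `prop33_rat`'s parity clause).
The level is spelled `((2 : ℕ) : ℤ)` (X11b's prime-level spelling, `CongruentTransfer.*` at `p = 2`).
-- TODO(general form): `δ_v` as the NORM index `dim E(K_v)/N E(F_w)` itself (Def. 2.6 verbatim; needs the norm map on
-- points of the completed base change), and Kramer's finer statements (Thm. 1: the rank formula; Thm. 2: the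
-- alternating pairing on everywhere-local/global norms).

Nothing is asserted: users take `(h : kramerParity K)`. Motivation / first consumer: the UP half of Cor. 3.4 (i) for the
cell's twins (`GenusKolyTwistLocal.natCard_selmerGroup_twist_eq_mul_two_of_local_of_isSquare`, whose displayed parity
hypothesis is this fact at `S = {v₀}`), making `cor34i_singleton_rat` / `prop33_rat` non-load-bearing.
-/

noncomputable section

open scoped Classical ContRepresentation

open NumberField WeierstrassCurve Literature.NumberTheory.EllipticCurves Literature.NumberTheory.GaloisRepresentations

namespace Literature.NumberTheory.EllipticCurves.MazurRubin2010

universe u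

/-- **Mazur–Rubin 2010, Theorem 2.7 (Kramer's congruence), with the local terms read through Lemma 2.9 and the
identification of Remark 2.4 — every number field `K`, `p = 2`** (Invent. Math. 181 (2010); Kramer, Trans. AMS 264
(1981) Thms 1–2, Prop. 7; verbatim in the module docstring). For an elliptic `E/K` (model `W`), a non-square `d ∈ K`
(`F = K(√d)`), any model `W'` of the twist `E^F = E^{(d)}`, the identification `φ : E^F[2] = E[2]` (an injective
continuous `Γ_K`-intertwining map which is the UNIQUE one, `huniq`), the local Kummer conditions of `E^F` transported
into `H¹(K_v, E[2])` (`𝓐 v = φ_* H¹_f(K_v, E^F[2])`), and any finite set of places `S` off which they agree with those of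
`E`: **`d₂(E^F/K) ≡ d₂(E/K) + Σ_{v} δ_v(E, F/K) (mod 2)`** with `2^{δ_v} = [H¹_f(K_v,E[2]) : H¹_f(K_v,E[2]) ∩ H¹_f(K_v,E^F[2])]`
— stated as: `#Sel₂(E^F) · #Sel₂(E) · ∏_{v∈S} [𝓚_{E,v} : 𝓐_v ⊓ 𝓚_{E,v}]` is a perfect square. Named fact (PUBLISHED);
nothing asserted, no `_holds`.
[cite: MazurRubin2010, Thm. 2.7 with Def. 2.6, Remark 2.4 and Lemma 2.9 (DASH copy p0007 L23–L66, p0008 L1–L24)]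
[cite: Kramer1981, Thm. 1 (p. 130), Thm. 2 and Prop. 7 (p. 132)] -/
def kramerParity (K : Type u) [Field K] [NumberField K] : Prop :=
  ∀ (W : WeierstrassCurve K) [W.IsElliptic] (d : K), (∀ x : K, x ^ 2 ≠ d) →
    ∀ (W' : WeierstrassCurve K) [W'.IsElliptic], (∃ C : VariableChange K, C • W' = W.quadraticTwist d) →
    -- the identification `E^F[2] = E[2]` (Remark 2.4): the unique injective intertwining map
    ∀ (φ : (W'.torsionGaloisModule ((2 : ℕ) : ℤ)).toContRepresentation →ⁱL
        (W.torsionGaloisModule ((2 : ℕ) : ℤ)).toContRepresentation),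
      Function.Injective φ →
      (∀ φ' : (W'.torsionGaloisModule ((2 : ℕ) : ℤ)).toContRepresentation →ⁱL
          (W.torsionGaloisModule ((2 : ℕ) : ℤ)).toContRepresentation,
        Function.Injective φ' → ∀ a, φ' a = φ a) →
    -- `H¹_f(K_v, E^F[2]) ⊂ H¹(K_v, E[2])`, transported along the identification
    ∀ (𝓐 : DiscreteGaloisModule.SelmerStructure (W.torsionGaloisModule ((2 : ℕ) : ℤ))),
      (∀ v, 𝓐 v = (W'.kummerSelmerStructure ((2 : ℕ) : ℤ) v).map
        (galoisCohomology.map (φ.restrictField (Place.Completion v)) 1)) →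
    -- `Σ_v δ_v` over any finite set of places off which `δ_v = 0`
    ∀ (S : Finset (Place K)), (∀ v ∉ S, 𝓐 v = W.kummerSelmerStructure ((2 : ℕ) : ℤ) v) →
      IsSquare (Nat.card (W'.selmerGroup ((2 : ℕ) : ℤ)) * Nat.card (W.selmerGroup ((2 : ℕ) : ℤ)) *
        ∏ v ∈ S, (𝓐 v).relIndex (W.kummerSelmerStructure ((2 : ℕ) : ℤ) v))

end Literature.NumberTheory.EllipticCurves.MazurRubin2010

end
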